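import Mathlib
import HarnessLib

/-!
# Elements with independent differentials extend to a minimal system of generators of `𝔪`
# (door `HypersurfaceCentreConstruction`, stmt-ResolutionOfSingularities-19897; KEY `stub_localWeightedDropEFT4S`, rung P3;
# res-type-005, (o28) lead object (P3a-7)(A), HOME/STATUS 2026-08-27T11:31:40Z)

Topic: `Summits/ResolutionOfSingularities/ResolutionOfSingularities/Theorems`. Helper for the door item
`HypersurfaceCentreConstruction` (stmt-ResolutionOfSingularities-19897, route `WeightedInvariant`).  The (pres) conjunct of
the canonical game clause `CanonicalGameClauseLE d` (`…LocalGameEFT4SDimLE`) presents the centre filtration on a FULL minimal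
system of generators `u : Fin n → S` of `𝔪_S` (`Ideal.span (range u) = 𝔪_S ∧ 𝔪_S.spanFinrank = n`), the centre being the
sub-family of positively weighted members.  At a cylinder position (regime P3a, ORDER (o28)) the centre is given by TWO
parameters `(x, g)` with independent differentials, so the clause needs the classical extension step proved here, for every
Noetherian local ring and every length:

* `exists_snoc_linearIndependent` — one more element of `𝔪` keeping the differentials independent, while their number is
  `< dim_k 𝔪/𝔪²` (Mathlib's `exists_linearIndependent_snoc_of_lt_finrank` + surjectivity of `𝔪 → 𝔪/𝔪²`);
* `exists_append_linearIndependent` — iterate: `r` more elements for every `c + r ≤ dim_k 𝔪/𝔪²`;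
* **`exists_rsp_extension`** — elements `v₁, …, v_c ∈ 𝔪` with `k`-linearly independent images in `𝔪/𝔪²` EXTEND to a minimal
  system of generators `Fin.append v y` of `𝔪` of length `spanFinrank 𝔪 = c + r` (Nakayama:
  `IsLocalRing.CotangentSpace.span_image_eq_top_iff`; `spanFinrank 𝔪 = dim_k 𝔪/𝔪²`); in a regular local ring this is a
  regular system of parameters through `v`.  `exists_rsp_extension'` is the `↥𝔪`-valued form with the independence of the
  extended family recorded.

[OURS · L1 W4.3 · (o28)/(P3a-7)]  Replaces the role of NO printed item; NOT a statement of the manuscript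
[claim: Hironaka2017, status: under-review]. AI work, weaker than expert review.  Pure commutative algebra over Mathlib.

## References

* H. Matsumura, Commutative Ring Theory (1987), Thm. 2.3 (minimal bases and `𝔪/𝔪²`), Thm. 14.2 (regular systems of
  parameters). [Matsumura1987]
-/

noncomputable section

open IsLocalRing Module

set_option linter.dupNamespace false -- mandated namespace of this single-conjunct summit

namespace Summit.ResolutionOfSingularities.ResolutionOfSingularities.Theorems

namespace RspExtension

variable {S : Type} [CommRing S] [IsLocalRing S]

/-- **One more parameter.**  If `u₁, …, uₙ ∈ 𝔪` have linearly independent differentials and `n < dim_k 𝔪/𝔪²`, some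
`x ∈ 𝔪` keeps the differentials of `(u, x)` independent. [cite: Matsumura1987, Thm. 2.3] -/
theorem exists_snoc_linearIndependent {n : ℕ} (u : Fin n → maximalIdeal S)
    (hli : LinearIndependent (ResidueField S) ((maximalIdeal S).toCotangent ∘ u))
    (hlt : n < finrank (ResidueField S) (CotangentSpace S)) :
    ∃ x : maximalIdeal S, LinearIndependent (ResidueField S) ((maximalIdeal S).toCotangent ∘ Fin.snoc u x) := by
  obtain ⟨ξ, hξ⟩ := exists_linearIndependent_snoc_of_lt_finrank hli hlt
  obtain ⟨x, rfl⟩ := (maximalIdeal S).toCotangent_surjective ξ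
  exact ⟨x, by rwa [Fin.comp_snoc]⟩

/-- **`r` more parameters**, for every `c + r ≤ dim_k 𝔪/𝔪²`. [cite: Matsumura1987, Thm. 2.3] -/
theorem exists_append_linearIndependent {c : ℕ} (v : Fin c → maximalIdeal S)
    (hli : LinearIndependent (ResidueField S) ((maximalIdeal S).toCotangent ∘ v)) :
    ∀ r : ℕ, c + r ≤ finrank (ResidueField S) (CotangentSpace S) →
      ∃ y : Fin r → maximalIdeal S,
        LinearIndependent (ResidueField S) ((maximalIdeal S).toCotangent ∘ Fin.append v y)
  | 0, _ => ⟨Fin.elim0, by rw [Fin.append_elim0]; exact hli.comp _ (Fin.cast_injective _)⟩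
  | r + 1, h => by
    obtain ⟨y, hy⟩ := exists_append_linearIndependent v hli r (by omega)
    obtain ⟨x, hx⟩ := exists_snoc_linearIndependent (Fin.append v y) hy (by omega)
    exact ⟨Fin.snoc y x, by rw [Fin.append_snoc]; exact hx⟩

/-- **Extension to a minimal system of generators, `↥𝔪`-valued form.**  `v₁, …, v_c ∈ 𝔪` with independent differentials
extend to a family `Fin.append v y` of length `spanFinrank 𝔪 = c + r` which generates `𝔪` and still has independent
differentials (a basis of `𝔪/𝔪²`). [cite: Matsumura1987, Thm. 2.3] -/
theorem exists_rsp_extension' [IsNoetherianRing S] {c : ℕ} (v : Fin c → maximalIdeal S)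
    (hli : LinearIndependent (ResidueField S) ((maximalIdeal S).toCotangent ∘ v)) :
    ∃ (r : ℕ) (y : Fin r → maximalIdeal S),
      Ideal.span (Set.range fun i => ((Fin.append v y i : maximalIdeal S) : S)) = maximalIdeal S ∧
      (maximalIdeal S).spanFinrank = c + r ∧
      LinearIndependent (ResidueField S) ((maximalIdeal S).toCotangent ∘ Fin.append v y) := by
  have hc : c ≤ finrank (ResidueField S) (CotangentSpace S) := by simpa using hli.fintype_card_le_finrank
  obtain ⟨y, hy⟩ := exists_append_linearIndependent v hli (finrank (ResidueField S) (CotangentSpace S) - c) (by omega)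
  refine ⟨finrank (ResidueField S) (CotangentSpace S) - c, y, ?_, ?_, hy⟩
  · have hcard : Fintype.card (Fin (c + (finrank (ResidueField S) (CotangentSpace S) - c))) =
        finrank (ResidueField S) (CotangentSpace S) := by
      rw [Fintype.card_fin]
      omega
    have htop := hy.span_eq_top_of_card_eq_finrank' hcard
    rw [Set.range_comp, IsLocalRing.CotangentSpace.span_image_eq_top_iff] at htop
    have hmap := congrArg (Submodule.map (maximalIdeal S).subtype) htop
    rw [Submodule.map_span, Submodule.map_top, Submodule.range_subtype, ← Set.range_comp] at hmap
    exact hmap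
  · rw [IsLocalRing.spanFinrank_maximalIdeal_eq_finrank_cotangentSpace]
    omega

/-- Coercing an appended `↥𝔪`-valued family to `S` commutes with `Fin.append`. [folklore] -/
theorem coe_append {c r : ℕ} (v : Fin c → maximalIdeal S) (y : Fin r → maximalIdeal S) :
    (fun i => ((Fin.append v y i : maximalIdeal S) : S)) = Fin.append (fun i => (v i : S)) (fun j => (y j : S)) := by
  funext i
  induction i using Fin.addCases with
  | left j => simp only [Fin.append_left]
  | right j => simp only [Fin.append_right]

/-- **Extension to a minimal system of generators.**  In a Noetherian local ring `(S, 𝔪, k)`, elements `v₁, …, v_c ∈ 𝔪`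
whose images in `𝔪/𝔪²` are `k`-linearly independent extend to a minimal system of generators of `𝔪`: there are
`y₁, …, y_r ∈ 𝔪` with `(v, y) = 𝔪` and `spanFinrank 𝔪 = c + r` (in a regular local ring: a regular system of parameters
through `v`). [cite: Matsumura1987, Thm. 2.3 and Thm. 14.2] -/
theorem exists_rsp_extension (S : Type) [CommRing S] [IsLocalRing S] [IsNoetherianRing S] {c : ℕ} (v : Fin c → S)
    (hv : ∀ i, v i ∈ maximalIdeal S)
    (hli : LinearIndependent (ResidueField S) fun i => (maximalIdeal S).toCotangent ⟨v i, hv i⟩) :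
    ∃ (r : ℕ) (y : Fin r → S), (∀ j, y j ∈ maximalIdeal S) ∧
      Ideal.span (Set.range (Fin.append v y)) = maximalIdeal S ∧ (maximalIdeal S).spanFinrank = c + r := by
  obtain ⟨r, y, hspan, hrank, -⟩ := exists_rsp_extension' (S := S) (fun i => ⟨v i, hv i⟩) hli
  refine ⟨r, fun j => (y j : S), fun j => (y j).2, ?_, hrank⟩
  rw [coe_append] at hspan
  exact hspan

/-- The same, recording that the extended family keeps independent differentials (a `k`-basis of `𝔪/𝔪²`).
[cite: Matsumura1987, Thm. 2.3 and Thm. 14.2] -/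
theorem exists_rsp_extension_linearIndependent (S : Type) [CommRing S] [IsLocalRing S] [IsNoetherianRing S] {c : ℕ}
    (v : Fin c → S) (hv : ∀ i, v i ∈ maximalIdeal S)
    (hli : LinearIndependent (ResidueField S) fun i => (maximalIdeal S).toCotangent ⟨v i, hv i⟩) :
    ∃ (r : ℕ) (y : Fin r → S) (hy : ∀ j, y j ∈ maximalIdeal S),
      Ideal.span (Set.range (Fin.append v y)) = maximalIdeal S ∧ (maximalIdeal S).spanFinrank = c + r ∧
      LinearIndependent (ResidueField S) fun i =>
        (maximalIdeal S).toCotangent ⟨Fin.append v y i, by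
          induction i using Fin.addCases with
          | left j => rw [Fin.append_left]; exact hv j
          | right j => rw [Fin.append_right]; exact hy j⟩ := by
  obtain ⟨r, y, hspan, hrank, hli'⟩ := exists_rsp_extension' (S := S) (fun i => ⟨v i, hv i⟩) hli
  refine ⟨r, fun j => (y j : S), fun j => (y j).2, ?_, hrank, ?_⟩
  · rw [coe_append] at hspan
    exact hspan
  · convert hli' using 1
    funext i
    simp only [Function.comp_apply]
    congr 1
    ext
    exact congrFun (coe_append (fun i => (⟨v i, hv i⟩ : maximalIdeal S)) y).symm i

end RspExtension

end Summit.ResolutionOfSingularities.ResolutionOfSingularities.Theorems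

end
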